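import Summits.ValiantsHypothesis.ValiantsHypothesis.Theorems.SymPencilPerFourInnerRankHypNine

/-!
# Route `SymPencil` — inner rank of the `2 | 2` row split of `per_4` on a SUBSPACE of the
# `u`-side, V: the star of column pairs through `0` (`--supports` stmt-ValiantsHypothesis-5674
# `SdcSuperquadratic`; toward IR9U/IR9H = cell `(9, 7, 8)` of the size-`27` table; rung currency only)

Setting as in `SymPencilPerFourInnerRankHypFamily/HypPairs/HypPurity/HypNine`: `hJ` on a submodule
`U ≤ K⁴ × K⁴`, a linear section `ρ` of the second projection into `U`, `H_a = {a : (a,0) ∈ U}`,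
`H_b = {b : (0,b) ∈ U}` of dimension `≥ 3`.

* `linePoly_linear`, `linePoly_mul` — closure of "polynomial along lines";
* `exists_good_point₀` — for `k ≠ 0`, if for every `m ≠ 0` some `(a, 0) ∈ U` has `a m ≠ 0`, then
  the section `U ∩ {u.2 ∈ span(e₀, e_k)}` carries a point with `u.1 m ≠ 0 (m ≠ 0)`,
  `u.2 0 ≠ 0`, `u.2 k ≠ 0`, `u.1 0 u.2 k + u.1 k u.2 0 ≠ 0` (six functions polynomial along lines,
  each non-zero somewhere on the section: `SymPencilPerFourHessianMinors.exists_ne_zero_and_ne_zero`);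
* **`false_of_star`** — NORMALISED MAIN LEMMA: `hJ` on `U` (all weights non-zero, `|ι| ≤ 9`), a
  section `ρ`, `dim H_a, H_b ≥ 3`, and for every `i ≠ 0` a point `(a, 0) ∈ U` with `a i ≠ 0` give
  `False`: the three STAR pairs `{0, k}` get their family alternatives (`family_pair_U`), the
  three labels agree (else column `0` is doubly pure: `false_of_doubly_pure₀`), and the pure
  case dies by `false_of_allA_U` (after `y₂ ↔ y₃` in the all-`B` case).

Honest framing: one normalisation (`i₀ ↦ 0`, existence of `ρ`, support reduction) away from
IR9U; cell `(9,7,8)` not killed in this file; `27 ≤ sdc(per_4) ≤ 29` unchanged; the crux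
`SdcSuperquadratic` and `VP ≠ VNP` untouched.  No definitions. [folklore]
-/

noncomputable section

-- single-conjunct layout: Sub = Summit, duplicated namespace component intended
set_option linter.dupNamespace false

namespace Summit.ValiantsHypothesis.ValiantsHypothesis.Theorems.SymPencilPerFourInnerRankHypStar

open Matrix Finset Module Polynomial
open Summit.ValiantsHypothesis.ValiantsHypothesis.Theorems.SymPencilPerFourHessianMinors
open Summit.ValiantsHypothesis.ValiantsHypothesis.Theorems.SymPencilPerFourInnerRankRows
open Summit.ValiantsHypothesis.ValiantsHypothesis.Theorems.SymPencilPerFourInnerRankHypFamily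
open Summit.ValiantsHypothesis.ValiantsHypothesis.Theorems.SymPencilPerFourInnerRankHypPairs
open Summit.ValiantsHypothesis.ValiantsHypothesis.Theorems.SymPencilPerFourInnerRankHypPurity
open Summit.ValiantsHypothesis.ValiantsHypothesis.Theorems.SymPencilPerFourInnerRankHypNine

variable {K : Type*} [Field K] {ι : Type*} [Fintype ι]

/-! ### Polynomiality along lines: closure properties -/

omit [Fintype ι] in
/-- A linear functional is polynomial along lines. [folklore] -/
theorem linePoly_linear {M : Type*} [AddCommGroup M] [Module K M] (φ : M →ₗ[K] K) (y₀ y : M) :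
    ∃ p : K[X], ∀ s : K, φ (y₀ + s • y) = p.eval s :=
  ⟨Polynomial.C (φ y₀) + Polynomial.C (φ y) * Polynomial.X, fun s => by
    rw [map_add, map_smul, smul_eq_mul, Polynomial.eval_add, Polynomial.eval_mul,
      Polynomial.eval_C, Polynomial.eval_C, Polynomial.eval_X, mul_comm]⟩

omit [Fintype ι] in
/-- Products of functions polynomial along lines are polynomial along lines. [folklore] -/
theorem linePoly_mul {M : Type*} [AddCommGroup M] [Module K M] (f g : M → K)
    (hf : ∀ y₀ y : M, ∃ p : K[X], ∀ s : K, f (y₀ + s • y) = p.eval s)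
    (hg : ∀ y₀ y : M, ∃ p : K[X], ∀ s : K, g (y₀ + s • y) = p.eval s) (y₀ y : M) :
    ∃ p : K[X], ∀ s : K, (f * g) (y₀ + s • y) = p.eval s := by
  obtain ⟨p, hp⟩ := hf y₀ y
  obtain ⟨q, hq⟩ := hg y₀ y
  exact ⟨p * q, fun s => by rw [Pi.mul_apply, Polynomial.eval_mul, ← hp s, ← hq s]⟩

/-! ### A good point on the section `U ∩ {u.2 ∈ span(e₀, e_k)}` -/

omit [Fintype ι] in
/-- **Good points of the star sections.**  See the module docstring. [folklore] -/
theorem exists_good_point₀ [CharZero K] (U : Submodule K ((Fin 4 → K) × (Fin 4 → K)))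
    (ρ : (Fin 4 → K) →ₗ[K] ((Fin 4 → K) × (Fin 4 → K))) (hρ2 : ∀ b, (ρ b).2 = b)
    (hρU : ∀ b, ρ b ∈ U)
    (hH : ∀ i : Fin 4, i ≠ 0 → ∃ a : Fin 4 → K,
      ((a, (0 : Fin 4 → K)) : (Fin 4 → K) × (Fin 4 → K)) ∈ U ∧ a i ≠ 0)
    (k : Fin 4) (hk : k ≠ 0) :
    ∃ u ∈ U, (∀ m, m ≠ 0 → m ≠ k → u.2 m = 0) ∧ (∀ m, m ≠ 0 → m ≠ k → u.1 m ≠ 0) ∧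
      u.2 0 ≠ 0 ∧ u.2 k ≠ 0 ∧ u.1 0 * u.2 k + u.1 k * u.2 0 ≠ 0 := by
  classical
  -- the section as a submodule: `W = U ⊓ {u : u.2 m = 0 for m ∉ {0, k}}`
  let π : ((Fin 4 → K) × (Fin 4 → K)) →ₗ[K] (Fin 4 → K) :=
    LinearMap.snd K (Fin 4 → K) (Fin 4 → K) -
      (LinearMap.proj 0 ∘ₗ LinearMap.snd K (Fin 4 → K) (Fin 4 → K)).smulRight (Pi.single 0 1) -
      (LinearMap.proj k ∘ₗ LinearMap.snd K (Fin 4 → K) (Fin 4 → K)).smulRight (Pi.single k 1)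
  have hπm : ∀ u m, π u m = u.2 m - u.2 0 * (Pi.single 0 (1 : K) : Fin 4 → K) m -
      u.2 k * (Pi.single k (1 : K) : Fin 4 → K) m := fun u m => by
    simp [π, sub_eq_add_neg, add_assoc]
  have hπ : ∀ u, π u = 0 ↔ ∀ m, m ≠ 0 → m ≠ k → u.2 m = 0 := by
    intro u
    constructor
    · intro h m hm0 hmk
      have := congr_fun h m
      rw [hπm, Pi.zero_apply] at this
      simpa [Pi.single_apply, hm0, hmk] using this
    · intro h
      funext m
      rw [hπm, Pi.zero_apply]
      by_cases hm0 : m = 0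
      · subst hm0; simp [hk]
      · by_cases hmk : m = k
        · subst hmk; simp [hm0]
        · simp [hm0, hmk, h m hm0 hmk]
  let W : Submodule K ((Fin 4 → K) × (Fin 4 → K)) := U ⊓ LinearMap.ker π
  have hW : ∀ u, u ∈ W ↔ u ∈ U ∧ ∀ m, m ≠ 0 → m ≠ k → u.2 m = 0 := fun u => by
    rw [Submodule.mem_inf, LinearMap.mem_ker, hπ]
  have hρW : ∀ j, j = 0 ∨ j = k → ρ (Pi.single j 1) ∈ W := by
    intro j hj
    rw [hW]
    refine ⟨hρU _, fun m hm0 hmk => ?_⟩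
    rw [hρ2]
    rcases hj with rfl | rfl
    · simp [hm0]
    · simp [hmk]
  have haW : ∀ a : Fin 4 → K, ((a, (0 : Fin 4 → K)) : (Fin 4 → K) × (Fin 4 → K)) ∈ U →
      ((a, (0 : Fin 4 → K)) : (Fin 4 → K) × (Fin 4 → K)) ∈ W := fun a ha => by
    rw [hW]; exact ⟨ha, fun m _ _ => rfl⟩
  -- the six functions, polynomial along lines
  let L20 : ((Fin 4 → K) × (Fin 4 → K)) →ₗ[K] K :=
    LinearMap.proj 0 ∘ₗ LinearMap.snd K (Fin 4 → K) (Fin 4 → K)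
  let L2k : ((Fin 4 → K) × (Fin 4 → K)) →ₗ[K] K :=
    LinearMap.proj k ∘ₗ LinearMap.snd K (Fin 4 → K) (Fin 4 → K)
  let L1 : Fin 4 → ((Fin 4 → K) × (Fin 4 → K)) →ₗ[K] K := fun m =>
    LinearMap.proj m ∘ₗ LinearMap.fst K (Fin 4 → K) (Fin 4 → K)
  have e20 : ∀ u, L20 u = u.2 0 := fun u => rfl
  have e2k : ∀ u, L2k u = u.2 k := fun u => rfl
  have e1 : ∀ m u, L1 m u = u.1 m := fun m u => rfl
  let F : ((Fin 4 → K) × (Fin 4 → K)) → K := fun u => u.1 0 * u.2 k + u.1 k * u.2 0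
  have hF : ∀ y₀ y, ∃ p : K[X], ∀ s : K, F (y₀ + s • y) = p.eval s := fun y₀ y =>
    ⟨(Polynomial.C (y₀.1 0) + Polynomial.C (y.1 0) * Polynomial.X) *
        (Polynomial.C (y₀.2 k) + Polynomial.C (y.2 k) * Polynomial.X) +
      (Polynomial.C (y₀.1 k) + Polynomial.C (y.1 k) * Polynomial.X) *
        (Polynomial.C (y₀.2 0) + Polynomial.C (y.2 0) * Polynomial.X), fun s => by
      simp only [F, Prod.fst_add, Prod.snd_add, Prod.smul_fst, Prod.smul_snd, Pi.add_apply,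
        Pi.smul_apply, smul_eq_mul, Polynomial.eval_add, Polynomial.eval_mul, Polynomial.eval_C,
        Polynomial.eval_X]
      ring⟩
  -- witnesses for each function
  obtain ⟨ak, hakU, hak⟩ := hH k hk
  have wF : ∃ u ∈ W, F u ≠ 0 := by
    by_cases hρk : (ρ (Pi.single 0 1)).1 k = 0
    · refine ⟨(ak, 0) + ρ (Pi.single 0 1), W.add_mem (haW ak hakU) (hρW 0 (Or.inl rfl)), ?_⟩
      simp [F, hρ2, hρk, hk.symm, hak]
    · refine ⟨(ak, 0) + (ak k / (ρ (Pi.single 0 1)).1 k) • ρ (Pi.single 0 1),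
        W.add_mem (haW ak hakU) (W.smul_mem _ (hρW 0 (Or.inl rfl))), ?_⟩
      simp only [F, Prod.fst_add, Prod.snd_add, Prod.smul_fst, Prod.smul_snd, Pi.add_apply,
        Pi.smul_apply, smul_eq_mul, hρ2, Pi.zero_apply, zero_add]
      simp [hk.symm, hak, hρk]
  have w1 : ∀ m, m ≠ 0 → ∃ u ∈ W, (L1 m) u ≠ 0 := fun m hm => by
    obtain ⟨a, haU, ha⟩ := hH m hm
    exact ⟨(a, 0), haW a haU, by simpa [e1] using ha⟩
  -- combine: all six non-zero at one point of `W`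
  have p1 := linePoly_linear (L1 1)
  have p12 := linePoly_mul _ _ p1 (linePoly_linear (L1 2))
  have p123 := linePoly_mul _ _ p12 (linePoly_linear (L1 3))
  have p1230 := linePoly_mul _ _ p123 (linePoly_linear L20)
  have p1230k := linePoly_mul _ _ p1230 (linePoly_linear L2k)
  obtain ⟨u₁, hu₁, h₁⟩ : ∃ u ∈ W, ((⇑(L1 1)) * (⇑(L1 2))) u ≠ 0 := by
    obtain ⟨x, hx, hx'⟩ := w1 1 (by decide)
    obtain ⟨y, hy, hy'⟩ := w1 2 (by decide)
    obtain ⟨u, hu, h, h'⟩ := exists_ne_zero_and_ne_zero W p1 (linePoly_linear (L1 2)) hx hy hx' hy'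
    exact ⟨u, hu, mul_ne_zero h h'⟩
  obtain ⟨u₂, hu₂, h₂⟩ : ∃ u ∈ W, ((⇑(L1 1)) * (⇑(L1 2)) * (⇑(L1 3))) u ≠ 0 := by
    obtain ⟨z, hz, hz'⟩ := w1 3 (by decide)
    obtain ⟨u, hu, h, h'⟩ := exists_ne_zero_and_ne_zero W p12 (linePoly_linear (L1 3)) hu₁ hz h₁ hz'
    exact ⟨u, hu, mul_ne_zero h h'⟩
  obtain ⟨u₃, hu₃, h₃⟩ : ∃ u ∈ W, ((⇑(L1 1)) * (⇑(L1 2)) * (⇑(L1 3)) * (⇑L20)) u ≠ 0 := by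
    obtain ⟨u, hu, h, h'⟩ := exists_ne_zero_and_ne_zero W p123 (linePoly_linear L20) hu₂
      (hρW 0 (Or.inl rfl)) h₂ (by simp [e20, hρ2])
    exact ⟨u, hu, mul_ne_zero h h'⟩
  obtain ⟨u₄, hu₄, h₄⟩ :
      ∃ u ∈ W, ((⇑(L1 1)) * (⇑(L1 2)) * (⇑(L1 3)) * (⇑L20) * (⇑L2k)) u ≠ 0 := by
    obtain ⟨u, hu, h, h'⟩ := exists_ne_zero_and_ne_zero W p1230 (linePoly_linear L2k) hu₃
      (hρW k (Or.inr rfl)) h₃ (by simp [e2k, hρ2])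
    exact ⟨u, hu, mul_ne_zero h h'⟩
  obtain ⟨z, hz, hz'⟩ := wF
  obtain ⟨u, hu, hprod, h₆⟩ := exists_ne_zero_and_ne_zero W p1230k hF hu₄ hz h₄ hz'
  rw [hW] at hu
  simp only [Pi.mul_apply, e1, e20, e2k, mul_ne_zero_iff] at hprod
  obtain ⟨⟨⟨⟨hm1, hm2⟩, hm3⟩, h0⟩, hkk⟩ := hprod
  refine ⟨u, hu.1, hu.2, fun m hm0 _ => ?_, h0, hkk, h₆⟩
  have hm4 : ∀ m : Fin 4, m = 0 ∨ m = 1 ∨ m = 2 ∨ m = 3 := by decide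
  rcases hm4 m with h | rfl | rfl | rfl
  · exact absurd h hm0
  exacts [hm1, hm2, hm3]

/-! ### The normalised main lemma -/

/-- **The star argument.**  See the module docstring. [folklore] -/
theorem false_of_star [CharZero K] [DecidableEq ι] (hι : Fintype.card ι ≤ 9) (c : ι → K)
    (hc : ∀ r, c r ≠ 0)
    (t : ι → (((Fin 4 → K) × (Fin 4 → K)) →ₗ[K] ((Fin 4 → K) × (Fin 4 → K)) →ₗ[K] K))
    (U : Submodule K ((Fin 4 → K) × (Fin 4 → K)))
    (hJ : ∀ u ∈ U, ∀ y₂ y₃ : Fin 4 → K,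
      ∑ r, c r * (t r u (y₂, y₃)) ^ 2 = (Matrix.of ![u.1, u.2, y₂, y₃]).permanent)
    (ρ : (Fin 4 → K) →ₗ[K] ((Fin 4 → K) × (Fin 4 → K))) (hρ2 : ∀ b, (ρ b).2 = b)
    (hρU : ∀ b, ρ b ∈ U)
    (hUa : 3 ≤ finrank K (U.comap (LinearMap.inl K (Fin 4 → K) (Fin 4 → K))))
    (hUb : 3 ≤ finrank K (U.comap (LinearMap.inr K (Fin 4 → K) (Fin 4 → K))))
    (hH : ∀ i : Fin 4, i ≠ 0 → ∃ a : Fin 4 → K,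
      ((a, (0 : Fin 4 → K)) : (Fin 4 → K) × (Fin 4 → K)) ∈ U ∧ a i ≠ 0) : False := by
  have alt := fun (k : Fin 4) (hk : k ≠ 0) =>
    family_pair_U hι c hc t U hJ ρ hρ2 hρU 0 k hk.symm (exists_good_point₀ U ρ hρ2 hρU hH k hk)
  have hy : ∀ y : Fin 4, y ≠ 0 →
      (∀ a : Fin 4 → K, ((a, (0 : Fin 4 → K)) : (Fin 4 → K) × (Fin 4 → K)) ∈ U →
        ∀ r, t r (a, 0) (Pi.single y 1, 0) = 0) ∨
      (∀ a : Fin 4 → K, ((a, (0 : Fin 4 → K)) : (Fin 4 → K) × (Fin 4 → K)) ∈ U →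
        ∀ r, t r (a, 0) (0, Pi.single y 1) = 0) :=
    fun y hy => (alt y hy).imp (fun h => h.2.1) (fun h => h.2.1)
  have dp := fun hτ hσ => false_of_doubly_pure₀ c t U hJ hUa hUb hτ hσ hy
  have hm4 : ∀ m : Fin 4, m = 0 ∨ m = 1 ∨ m = 2 ∨ m = 3 := by decide
  -- the `y₂ ↔ y₃` swapped forms, for the all-`B` case
  set t' : ι → (((Fin 4 → K) × (Fin 4 → K)) →ₗ[K] ((Fin 4 → K) × (Fin 4 → K)) →ₗ[K] K) :=
    fun r => (t r).compl₂ (LinearEquiv.prodComm K (Fin 4 → K) (Fin 4 → K)).toLinearMap with ht'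
  have hev : ∀ r (u : (Fin 4 → K) × (Fin 4 → K)) (v w : Fin 4 → K), t' r u (v, w) = t r u (w, v) :=
    fun r u v w => rfl
  have hJ' := hJ_yswap_U c t U hJ
  rcases alt 1 (by decide) with A1 | B1 <;> rcases alt 2 (by decide) with A2 | B2 <;>
    rcases alt 3 (by decide) with A3 | B3
  · -- all `A`: the pure case
    refine false_of_allA_U hι c t U hJ ρ hρ2 hρU hUa (fun k => ?_) (fun j => ?_) (fun x hx => ?_)
    · rcases hm4 k with rfl | rfl | rfl | rfl
      exacts [A1.1, A1.2.1, A2.2.1, A3.2.1]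
    · rcases hm4 j with rfl | rfl | rfl | rfl
      exacts [A1.2.2.1, A1.2.2.2.1, A2.2.2.2.1, A3.2.2.2.1]
    · rcases hm4 x with rfl | rfl | rfl | rfl
      · exact absurd rfl hx
      exacts [A1.2.2.2.2, A2.2.2.2.2, A3.2.2.2.2]
  · exact dp A1.1 B3.1
  · exact dp A1.1 B2.1
  · exact dp A1.1 B2.1
  · exact dp A2.1 B1.1
  · exact dp A2.1 B1.1
  · exact dp A3.1 B1.1
  · -- all `B`: swap `y₂ ↔ y₃` and run the pure case
    refine false_of_allA_U hι c t' U hJ' ρ hρ2 hρU hUa (fun k a ha r => ?_) (fun j r => ?_)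
      (fun x hx r => ?_)
    · rw [hev]
      rcases hm4 k with rfl | rfl | rfl | rfl
      exacts [B1.1 a ha r, B1.2.1 a ha r, B2.2.1 a ha r, B3.2.1 a ha r]
    · rw [hev]
      rcases hm4 j with rfl | rfl | rfl | rfl
      exacts [B1.2.2.1 r, B1.2.2.2.1 r, B2.2.2.2.1 r, B3.2.2.2.1 r]
    · rw [hev, hev]
      rcases hm4 x with rfl | rfl | rfl | rfl
      · exact absurd rfl hx
      exacts [B1.2.2.2.2 r, B2.2.2.2.2 r, B3.2.2.2.2 r]

end Summit.ValiantsHypothesis.ValiantsHypothesis.Theorems.SymPencilPerFourInnerRankHypStar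

end
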